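import Summits.QuantumFields.BalabanUV.T4Continuum.Support.VariationalVectorAvgGDecomposition
import Summits.QuantumFields.BalabanUV.T4Continuum.Support.VariationalVectorOneStepPhys

/-!
# T⁴ programme, spine node NE2 (U1a), lane P2 — «V-AVG-G», file 6: DIV-AVG AT FLAT DATA — the commutator of the divergence with the one-step LINE average
# against `L`× the one-step BLOCK mean is an `O(L)`-window average of SECOND differences: `ε_D = 2√d∕n` (the K-test of the END's one displayed lower leg;
# model level; cell `pub-balaban`)

NE2 formalisation swarm `b2b-balaban-t4-ne2-formalise-*`, leaf prover 10 GEN 4 (`prover-b2b-balaban-t4-ne2-formalise-leaf-10-g4-0`, V-END holder lineage); journal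
INTENT «V-AVG-G: THE LOWER BRACKET WITHOUT A SLICE MOVE» CLAIMS.log 2026-08-20 18:22Z l.19093, file 6.  On top of leaf-03-g4's `QvL` (`VectorLineTransport`), the
colour road's `Qcv` ∕ `cDv` ∕ `dirUv` (`VariationalColourFederbush`), `divV` (`VariationalVectorWeitzenbock`), leaf-01-g6's `hessV` (`VariationalVectorOneStep`) and [B5]'s
block bijection (`sum_blocks_real` ∕ `sum_blocks_translate`, `bpt_add_tstep`, `tstep_succ`) BY NAME; nothing defined.

THE STATEMENT.  Flat data (`R = R′ = 1`, line carriers `1`, site transports `1`), block side `L`, coarse torus `Tor N`, fine torus `Tor (fine L N)`, an `E`-valued fine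
1-form `g`.  Writing `h_μ(x) = g(x − e_μ, μ) − g(x, μ)` (so that `div g = Σ_μ h_μ`) and `b_j = bpt y j`:
 * §2 **`divAvg_flat_pointwise`** — the EXACT identity
   `div(Q₁ g)(y) − L•Q₀(div g)(y) = (L^{d+1})⁻¹ • Σ_μ Σ_j Σ_{t<L} Σ_{s<L} ( h_μ(b_j + t e_μ − s e_μ) − h_μ(b_j) )`
   (the coarse divergence of the line average moves each line by ONE BLOCK = `L` fine steps, which telescopes into `L` one-step moves; `L•Q₀(div g)` is the same
   sum with the un-moved `h_μ(b_j)`);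
 * §3 **`divAvg_flat_sq_le`** — `Σ_y ‖div(Q₁ g)(y) − L•Q₀(div g)(y)‖² ≤ 4d·L^{4−d}·hessV 1 g`
   (each bracket is a signed sum of at most `2L` forward differences of `h_μ` along the window `b_j − s e_μ + [0, L) e_μ`; Cauchy–Schwarz over the `d·L^d·L²`
   indices, the block bijection + translation invariance, and `D⁺_μ h_μ(x) = −(D⁺_μD⁺_μ g_μ)(x − e_μ)` — ONE diagonal entry of `hessV`);
 * §4 **`divAvg_flat`** — END units, `N := fine n M`: `√((n^d)⁻¹n²)·‖toLp(div(Q₁ g)) − toLp(L•Q₀(div g))‖ ≤ (2√d·n⁻¹)·√(((nL)⁴∕(nL)^d)·hessV 1 g)` —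
   EXACTLY the `hDIV` binder of file 5's `avgG_projG_of_divAvg` ∕ the DIV-AVG leg of file 3 at flat data, with `ε_D = 2√d∕n = 2√d·L^{−k}` along `n = L^k`
   (GEOMETRIC, ratio `L⁻¹`) and `ρ_D =` the level-`nL` vector regularity functional `rhoV`-shape `((nL)⁴∕(nL)^d)·hessV` (whose V-REG at fine minimisers is the
   END's `hREGf`).
So at `U = 1` the one displayed analytic leg of the (G″) route IS INHABITED with a first-order, geometrically decaying constant — the non-vacuity certificate of the
re-socketed lower bracket (`VariationalVectorEndOfLeavesAvgG`).  WITH BACKGROUND the same telescoping carries the line carriers and the bond transports; the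
commutation defects are the plaquette ∕ in-block mismatch quantities of the class — OPEN (next files).

HONEST FRAMING (T4-DAG p. 1).  Flat data, MODEL level (`E`-valued 1-forms; c5); [folklore] lattice telescoping + Cauchy–Schwarz; nothing printed is a hypothesis; no
`def`, no `def … : Prop`, no `sorry`; axioms standard.  DIV-AVG WITH BACKGROUND NOT proved here; V-END with background ∕ NE2 NOT proved; NE3 OPEN; spine PROVED 0∕9
unchanged; rung (B)+1 on a fixed finite T⁴ — NOT infinite volume, NOT mass gap, NOT Clay.  HONEST DEPENDENCY (cell, verbatim): continuum YM on T⁴ ⇐ BetaPertH ∧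
nine spine estimates (0/9 proved); BetaPertH ⇐ (D1) ∧ (D4) ∧ CAP+tail; G-an2-4 gates asym, D1 and NE2/3/4.
-/

noncomputable section

namespace Summit.QuantumFields.BalabanUV.T4Continuum.VariationalVectorDivAvgFlat

open Finset WithLp
open Literature.MathematicalPhysics.QuantumFieldTheory.Balaban1983to89.B5Prop11Plancherel (Tor fine unitVec)
open Literature.MathematicalPhysics.QuantumFieldTheory.Balaban1983to89.B5Block118 (tstep bpt tstep_zero tstep_succ bpt_add_tstep)
open Literature.MathematicalPhysics.QuantumFieldTheory.Balaban1983to89.B5AverageCurlStokes (sum_blocks_real sum_translate)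
open Summit.QuantumFields.BalabanUV.T4Continuum.VariationalCovariantFederbush (sq_sum_le_card_mul sum_blocks_translate)
open Summit.QuantumFields.BalabanUV.T4Continuum.VariationalColourFederbush (cDv dirUv dirUv_nonneg Qcv)
open Summit.QuantumFields.BalabanUV.T4Continuum.VariationalColourInterpolant (hessv hessv_nonneg)
open Summit.QuantumFields.BalabanUV.T4Continuum.VariationalVectorOneStep (hessV)
open Summit.QuantumFields.BalabanUV.T4Continuum.VectorBlockTrialForm (QvL)
open Summit.QuantumFields.BalabanUV.T4Continuum.VariationalVectorWeitzenbock (divV divV_apply)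
open Summit.QuantumFields.BalabanUV.T4Continuum.VariationalVectorGaugeSlice (norm_toLp_sq)

variable {d : ℕ} {E : Type*} [NormedAddCommGroup E] [InnerProductSpace ℂ E] [CompleteSpace E]
variable (L : ℕ) [NeZero L] (N : Fin d → ℕ) [hN : ∀ μ, NeZero (N μ)]

/-! ## §1 Flat formulas and the two telescopings -/

omit [CompleteSpace E] [NeZero L] hN in
/-- the flat line average, unfolded: `Q₁ g (y,μ) = (L^{d+1})⁻¹ • Σ_j Σ_t g(b_j + t e_μ, μ)`. [folklore] -/
theorem QvL_flat_apply (g : Tor (fine L N) → Fin d → E) (y : Tor N) (μ : Fin d) :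
    QvL L N (fun _ _ _ _ => (1 : E →L[ℂ] E)) g y μ
      = (((L : ℂ) ^ (d + 1))⁻¹ : ℂ) • ∑ j : Fin d → Fin L, ∑ t : Fin L, g (bpt L N y j + tstep (fine L N) μ t) μ := by
  unfold QvL; simp only [one_apply_eq_self]

omit [CompleteSpace E] [NeZero L] hN in
/-- the flat block mean, unfolded: `Q₀ f (y) = (L^d)⁻¹ • Σ_j f(b_j)`. [folklore] -/
theorem Qcv_flat_apply (f : Tor (fine L N) → E) (y : Tor N) :
    Qcv L N (fun _ => (1 : E →L[ℂ] E)) f y = (((L : ℂ) ^ d)⁻¹ : ℂ) • ∑ j : Fin d → Fin L, f (bpt L N y j) := by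
  unfold Qcv; simp only [one_apply_eq_self]

/-- the flat divergence, unfolded: `div W (x) = Σ_μ (W(x − e_μ, μ) − W(x, μ))`. [folklore] -/
theorem divV_flat_apply {P : Fin d → ℕ} [∀ μ, NeZero (P μ)] (W : Tor P → Fin d → E) (x : Tor P) :
    divV P (fun _ _ => (1 : E →L[ℂ] E)) W x = ∑ μ, (W (x - unitVec P μ) μ - W x μ) := by
  rw [divV_apply]; simp only [star_one, one_apply_eq_self]

omit [NeZero L] hN in
/-- a block shift is `L` fine steps: `bpt (y − e_μ) j = bpt y j − L e_μ`. [folklore] -/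
theorem bpt_sub_unitVec (y : Tor N) (j : Fin d → Fin L) (μ : Fin d) :
    bpt L N (y - unitVec N μ) j = bpt L N y j - tstep (fine L N) μ L := by
  have h := bpt_add_tstep L N (y - unitVec N μ) j μ
  rw [sub_add_cancel] at h
  exact eq_sub_of_add_eq h

omit [InnerProductSpace ℂ E] [CompleteSpace E] in
/-- **FIRST TELESCOPING**: `f(z − m e_μ) − f(z) = Σ_{s<m} ( f(z − s e_μ − e_μ) − f(z − s e_μ) )`. [folklore] -/
theorem telescope_tstep {P : Fin d → ℕ} (f : Tor P → E) (z : Tor P) (μ : Fin d) (m : ℕ) :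
    f (z - tstep P μ m) - f z = ∑ s ∈ range m, (f (z - tstep P μ s - unitVec P μ) - f (z - tstep P μ s)) := by
  induction m with
  | zero => simp [tstep_zero]
  | succ m ih =>
    rw [sum_range_succ, ← ih, tstep_succ, sub_add_eq_sub_sub]
    abel

omit [InnerProductSpace ℂ E] [CompleteSpace E] in
/-- **SECOND TELESCOPING**: `H(b + t e_μ − s e_μ) − H(b) = Σ_{r<t} D⁺H(b − s e_μ + r e_μ) − Σ_{r<s} D⁺H(b − s e_μ + r e_μ)`, `D⁺H(w) = H(w + e_μ) − H(w)`. [folklore] -/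
theorem telescope_diff {P : Fin d → ℕ} (H : Tor P → E) (b : Tor P) (μ : Fin d) (t s : ℕ) :
    H (b + tstep P μ t - tstep P μ s) - H b
      = (∑ r ∈ range t, (H (b - tstep P μ s + tstep P μ r + unitVec P μ) - H (b - tstep P μ s + tstep P μ r)))
        - ∑ r ∈ range s, (H (b - tstep P μ s + tstep P μ r + unitVec P μ) - H (b - tstep P μ s + tstep P μ r)) := by
  have h1 : ∑ r ∈ range t, (H (b - tstep P μ s + tstep P μ r + unitVec P μ) - H (b - tstep P μ s + tstep P μ r))
      = H (b - tstep P μ s + tstep P μ t) - H (b - tstep P μ s + tstep P μ 0) := by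
    rw [← sum_range_sub (fun r => H (b - tstep P μ s + tstep P μ r)) t]
    refine sum_congr rfl fun r _ => ?_
    rw [tstep_succ, add_assoc]
  have h2 : ∑ r ∈ range s, (H (b - tstep P μ s + tstep P μ r + unitVec P μ) - H (b - tstep P μ s + tstep P μ r))
      = H (b - tstep P μ s + tstep P μ s) - H (b - tstep P μ s + tstep P μ 0) := by
    rw [← sum_range_sub (fun r => H (b - tstep P μ s + tstep P μ r)) s]
    refine sum_congr rfl fun r _ => ?_
    rw [tstep_succ, add_assoc]
  rw [h1, h2, tstep_zero, add_zero, sub_add_cancel, show b + tstep P μ t - tstep P μ s = b - tstep P μ s + tstep P μ t by abel]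
  abel

omit [InnerProductSpace ℂ E] [CompleteSpace E] [NeZero L] in
/-- hence, for `t, s < L`: `‖H(b + t e_μ − s e_μ) − H(b)‖ ≤ 2·Σ_{r<L} ‖D⁺H(b − s e_μ + r e_μ)‖`. [folklore] -/
theorem norm_telescope_diff_le {P : Fin d → ℕ} (H : Tor P → E) (b : Tor P) (μ : Fin d) {t s : ℕ} (ht : t ≤ L) (hs : s ≤ L) :
    ‖H (b + tstep P μ t - tstep P μ s) - H b‖
      ≤ 2 * ∑ r ∈ range L, ‖H (b - tstep P μ s + tstep P μ r + unitVec P μ) - H (b - tstep P μ s + tstep P μ r)‖ := by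
  rw [telescope_diff]
  have hsub : ∀ u, u ≤ L → ‖∑ r ∈ range u, (H (b - tstep P μ s + tstep P μ r + unitVec P μ) - H (b - tstep P μ s + tstep P μ r))‖
      ≤ ∑ r ∈ range L, ‖H (b - tstep P μ s + tstep P μ r + unitVec P μ) - H (b - tstep P μ s + tstep P μ r)‖ := fun u hu =>
    (norm_sum_le _ _).trans (sum_le_sum_of_subset_of_nonneg (fun x hx => mem_range.mpr (lt_of_lt_of_le (mem_range.mp hx) hu)) fun _ _ _ => norm_nonneg _)
  calc _ ≤ ‖∑ r ∈ range t, (H (b - tstep P μ s + tstep P μ r + unitVec P μ) - H (b - tstep P μ s + tstep P μ r))‖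
        + ‖∑ r ∈ range s, (H (b - tstep P μ s + tstep P μ r + unitVec P μ) - H (b - tstep P μ s + tstep P μ r))‖ := norm_sub_le _ _
    _ ≤ _ := by linarith [hsub t ht, hsub s hs]

/-! ## §2 The exact commutator identity at flat data -/

omit [CompleteSpace E] [NeZero L] hN in
/-- the coarse difference of the line average, one component: `Q₁g(y − e_μ, μ) − Q₁g(y, μ) = (L^{d+1})⁻¹ • Σ_j Σ_t Σ_{s<L} h_μ(b_j + t e_μ − s e_μ)`,
`h_μ(x) = g(x − e_μ, μ) − g(x, μ)`. [folklore] -/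
theorem QvL_flat_sub (g : Tor (fine L N) → Fin d → E) (y : Tor N) (μ : Fin d) :
    QvL L N (fun _ _ _ _ => (1 : E →L[ℂ] E)) g (y - unitVec N μ) μ - QvL L N (fun _ _ _ _ => (1 : E →L[ℂ] E)) g y μ
      = (((L : ℂ) ^ (d + 1))⁻¹ : ℂ) • ∑ j : Fin d → Fin L, ∑ t : Fin L, ∑ s ∈ range L,
          (g (bpt L N y j + tstep (fine L N) μ t - tstep (fine L N) μ s - unitVec (fine L N) μ) μ
            - g (bpt L N y j + tstep (fine L N) μ t - tstep (fine L N) μ s) μ) := by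
  rw [QvL_flat_apply, QvL_flat_apply, ← smul_sub, ← sum_sub_distrib]
  congr 1
  refine sum_congr rfl fun j _ => ?_
  rw [← sum_sub_distrib]
  refine sum_congr rfl fun t _ => ?_
  rw [bpt_sub_unitVec, show bpt L N y j - tstep (fine L N) μ L + tstep (fine L N) μ t = bpt L N y j + tstep (fine L N) μ t - tstep (fine L N) μ L by abel]
  exact telescope_tstep (fun z => g z μ) _ μ L

/-- **THE COMMUTATOR AT FLAT DATA, EXACTLY**: `div(Q₁ g)(y) − L•Q₀(div g)(y) = (L^{d+1})⁻¹ • Σ_μ Σ_j Σ_t Σ_{s<L} ( h_μ(b_j + t e_μ − s e_μ) − h_μ(b_j) )`. [folklore] -/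
theorem divAvg_flat_pointwise (g : Tor (fine L N) → Fin d → E) (y : Tor N) :
    divV N (fun _ _ => (1 : E →L[ℂ] E)) (QvL L N (fun _ _ _ _ => (1 : E →L[ℂ] E)) g) y
        - (L : ℂ) • Qcv L N (fun _ => (1 : E →L[ℂ] E)) (divV (fine L N) (fun _ _ => (1 : E →L[ℂ] E)) g) y
      = (((L : ℂ) ^ (d + 1))⁻¹ : ℂ) • ∑ μ : Fin d, ∑ j : Fin d → Fin L, ∑ t : Fin L, ∑ s ∈ range L,
          ((g (bpt L N y j + tstep (fine L N) μ t - tstep (fine L N) μ s - unitVec (fine L N) μ) μ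
              - g (bpt L N y j + tstep (fine L N) μ t - tstep (fine L N) μ s) μ)
            - (g (bpt L N y j - unitVec (fine L N) μ) μ - g (bpt L N y j) μ)) := by
  have hL : (L : ℂ) ≠ 0 := by exact_mod_cast NeZero.ne L
  -- constant double sums: `Σ_t Σ_s c = (L·L) • c`
  have hconst : ∀ c : E, (∑ _t : Fin L, ∑ _s ∈ range L, c) = ((L : ℂ) * L) • c := fun c => by
    rw [sum_const, sum_const, card_range, Finset.card_univ, Fintype.card_fin, smul_smul, ← Nat.cast_smul_eq_nsmul ℂ, Nat.cast_mul]
  -- the first term component by component (`QvL_flat_sub`), the second term unfolded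
  rw [divV_flat_apply, sum_congr rfl fun μ _ => QvL_flat_sub L N g y μ, ← smul_sum, Qcv_flat_apply, smul_smul]
  simp only [divV_flat_apply]
  -- RHS: split the summand difference; the un-moved part is constant in `(t, s)`
  have hsplit : (∑ μ : Fin d, ∑ j : Fin d → Fin L, ∑ t : Fin L, ∑ s ∈ range L,
          ((g (bpt L N y j + tstep (fine L N) μ t - tstep (fine L N) μ s - unitVec (fine L N) μ) μ
              - g (bpt L N y j + tstep (fine L N) μ t - tstep (fine L N) μ s) μ)
            - (g (bpt L N y j - unitVec (fine L N) μ) μ - g (bpt L N y j) μ)))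
        = (∑ μ : Fin d, ∑ j : Fin d → Fin L, ∑ t : Fin L, ∑ s ∈ range L,
            (g (bpt L N y j + tstep (fine L N) μ t - tstep (fine L N) μ s - unitVec (fine L N) μ) μ
              - g (bpt L N y j + tstep (fine L N) μ t - tstep (fine L N) μ s) μ))
          - ((L : ℂ) * L) • ∑ μ : Fin d, ∑ j : Fin d → Fin L, (g (bpt L N y j - unitVec (fine L N) μ) μ - g (bpt L N y j) μ) := by
    simp only [sum_sub_distrib, hconst, smul_sub, smul_sum]
  rw [hsplit, smul_sub, smul_smul]
  congr 1
  rw [Finset.sum_comm]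
  congr 1
  rw [pow_succ]
  field_simp

/-! ## §3 The bound: an `O(L)`-window of second differences -/

omit [CompleteSpace E] in
/-- the forward difference of `h_μ` is minus a forward second difference of `g_μ` one step back:
`h_μ(w + e_μ) − h_μ(w) = −(D⁺_μD⁺_μ g_μ)(w − e_μ)`, so the norms agree. [folklore] -/
theorem norm_diff_h_eq {P : Fin d → ℕ} (g : Tor P → Fin d → E) (w : Tor P) (μ : Fin d) :
    ‖(g (w + unitVec P μ - unitVec P μ) μ - g (w + unitVec P μ) μ) - (g (w - unitVec P μ) μ - g w μ)‖
      = ‖cDv P (fun _ _ => (1 : E →L[ℂ] E)) (fun z => cDv P (fun _ _ => (1 : E →L[ℂ] E)) (fun x => g x μ) z μ) (w - unitVec P μ) μ‖ := by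
  rw [add_sub_cancel_right]
  simp only [cDv, one_apply_eq_self, sub_add_cancel]
  rw [← norm_neg]
  congr 1
  abel

omit [CompleteSpace E] in
/-- the diagonal second differences are ONE entry of the full forward Hessian (ANY bond transports `R`): `Σ_μ Σ_x ‖(D_μD_μ g_μ)(x)‖² ≤ hessV R g`. [folklore] -/
theorem sum_diag_le_hessV {P : Fin d → ℕ} [∀ μ, NeZero (P μ)] (R : Tor P → Fin d → (E →L[ℂ] E)) (g : Tor P → Fin d → E) :
    ∑ μ, ∑ x, ‖cDv P R (fun z => cDv P R (fun x => g x μ) z μ) x μ‖ ^ 2 ≤ hessV P R g := by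
  unfold hessV hessv
  refine sum_le_sum fun μ _ => ?_
  calc ∑ x, ‖cDv P R (fun z => cDv P R (fun x => g x μ) z μ) x μ‖ ^ 2
      = dirUv P R (fun z => cDv P R (fun x => g x μ) z μ) μ := rfl
    _ ≤ ∑ ν, dirUv P R (fun z => cDv P R (fun x => g x μ) z ν) μ :=
        single_le_sum (f := fun ν => dirUv P R (fun z => cDv P R (fun x => g x μ) z ν) μ) (fun ν _ => dirUv_nonneg _ _ _ _) (mem_univ μ)
    _ ≤ ∑ κ, ∑ ν, dirUv P R (fun z => cDv P R (fun x => g x μ) z ν) κ :=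
        single_le_sum (f := fun κ => ∑ ν, dirUv P R (fun z => cDv P R (fun x => g x μ) z ν) κ)
          (fun κ _ => sum_nonneg fun ν _ => dirUv_nonneg _ _ _ _) (mem_univ μ)

/-- **THE SQUARE-SUM BOUND**: `Σ_y ‖div(Q₁ g)(y) − L•Q₀(div g)(y)‖² ≤ 4d·L⁴·(L^d)⁻¹·hessV 1 g`. [folklore] -/
theorem divAvg_flat_sq_le (g : Tor (fine L N) → Fin d → E) :
    ∑ y, ‖divV N (fun _ _ => (1 : E →L[ℂ] E)) (QvL L N (fun _ _ _ _ => (1 : E →L[ℂ] E)) g) y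
        - (L : ℂ) • Qcv L N (fun _ => (1 : E →L[ℂ] E)) (divV (fine L N) (fun _ _ => (1 : E →L[ℂ] E)) g) y‖ ^ 2
      ≤ 4 * d * (L : ℝ) ^ 4 * ((L : ℝ) ^ d)⁻¹ * hessV (fine L N) (fun _ _ => (1 : E →L[ℂ] E)) g := by
  have hL : (0 : ℝ) < L := by exact_mod_cast Nat.pos_of_ne_zero (NeZero.ne L)
  have hLd : (0 : ℝ) < (L : ℝ) ^ d := by positivity
  -- abbreviations: the one-step difference `h_μ` and its forward difference `Dh_μ`
  set h : Fin d → Tor (fine L N) → E := fun μ x => g (x - unitVec (fine L N) μ) μ - g x μ with hh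
  set Dh : Fin d → Tor (fine L N) → E := fun μ w => h μ (w + unitVec (fine L N) μ) - h μ w with hDh
  -- §a pointwise: the identity, the triangle inequality and the second telescoping
  have hpt : ∀ y, ‖divV N (fun _ _ => (1 : E →L[ℂ] E)) (QvL L N (fun _ _ _ _ => (1 : E →L[ℂ] E)) g) y
        - (L : ℂ) • Qcv L N (fun _ => (1 : E →L[ℂ] E)) (divV (fine L N) (fun _ _ => (1 : E →L[ℂ] E)) g) y‖
      ≤ ((L : ℝ) ^ (d + 1))⁻¹ * (2 * (L : ℝ) * ∑ μ : Fin d, ∑ j : Fin d → Fin L, ∑ s ∈ range L, ∑ r ∈ range L,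
          ‖Dh μ (bpt L N y j - tstep (fine L N) μ s + tstep (fine L N) μ r)‖) := fun y => by
    rw [divAvg_flat_pointwise, norm_smul, norm_inv, norm_pow, Complex.norm_natCast]
    refine mul_le_mul_of_nonneg_left ?_ (by positivity)
    -- each bracket: `‖h_μ(b + t − s) − h_μ(b)‖ ≤ 2 Σ_r ‖Dh_μ(b − s + r)‖`
    have hbr : ∀ (μ : Fin d) (j : Fin d → Fin L) (t : Fin L) (s : ℕ), s ∈ range L →
        ‖(g (bpt L N y j + tstep (fine L N) μ t - tstep (fine L N) μ s - unitVec (fine L N) μ) μ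
            - g (bpt L N y j + tstep (fine L N) μ t - tstep (fine L N) μ s) μ)
          - (g (bpt L N y j - unitVec (fine L N) μ) μ - g (bpt L N y j) μ)‖
        ≤ 2 * ∑ r ∈ range L, ‖Dh μ (bpt L N y j - tstep (fine L N) μ s + tstep (fine L N) μ r)‖ := by
      intro μ j t s hs
      have e : (g (bpt L N y j + tstep (fine L N) μ t - tstep (fine L N) μ s - unitVec (fine L N) μ) μ
            - g (bpt L N y j + tstep (fine L N) μ t - tstep (fine L N) μ s) μ)
          - (g (bpt L N y j - unitVec (fine L N) μ) μ - g (bpt L N y j) μ)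
          = h μ (bpt L N y j + tstep (fine L N) μ t - tstep (fine L N) μ s) - h μ (bpt L N y j) := by simp only [hh]
      rw [e]
      exact norm_telescope_diff_le L (h μ) (bpt L N y j) μ (le_of_lt t.isLt) (le_of_lt (mem_range.mp hs))
    calc _ ≤ ∑ μ : Fin d, ∑ j : Fin d → Fin L, ∑ t : Fin L, ∑ s ∈ range L,
            2 * ∑ r ∈ range L, ‖Dh μ (bpt L N y j - tstep (fine L N) μ s + tstep (fine L N) μ r)‖ := by
          refine (norm_sum_le _ _).trans (sum_le_sum fun μ _ => (norm_sum_le _ _).trans (sum_le_sum fun j _ =>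
            (norm_sum_le _ _).trans (sum_le_sum fun t _ => (norm_sum_le _ _).trans (sum_le_sum fun s hs => hbr μ j t s hs))))
      _ = 2 * (L : ℝ) * ∑ μ : Fin d, ∑ j : Fin d → Fin L, ∑ s ∈ range L, ∑ r ∈ range L,
            ‖Dh μ (bpt L N y j - tstep (fine L N) μ s + tstep (fine L N) μ r)‖ := by
          simp only [sum_const, Finset.card_univ, Fintype.card_fin, nsmul_eq_mul, mul_sum]
          refine sum_congr rfl fun μ _ => sum_congr rfl fun j _ => sum_congr rfl fun s _ => sum_congr rfl fun r _ => by ring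
  -- §b Cauchy–Schwarz over the `d·L^d·L·L` indices
  have hcs : ∀ y, (∑ μ : Fin d, ∑ j : Fin d → Fin L, ∑ s ∈ range L, ∑ r ∈ range L, ‖Dh μ (bpt L N y j - tstep (fine L N) μ s + tstep (fine L N) μ r)‖) ^ 2
      ≤ d * ((L : ℝ) ^ d * (L * (L * ∑ μ : Fin d, ∑ j : Fin d → Fin L, ∑ s ∈ range L, ∑ r ∈ range L,
          ‖Dh μ (bpt L N y j - tstep (fine L N) μ s + tstep (fine L N) μ r)‖ ^ 2))) := fun y => by
    have c1 := sq_sum_le_card_mul Finset.univ (fun μ : Fin d => ∑ j : Fin d → Fin L, ∑ s ∈ range L, ∑ r ∈ range L,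
      ‖Dh μ (bpt L N y j - tstep (fine L N) μ s + tstep (fine L N) μ r)‖)
    rw [Finset.card_univ, Fintype.card_fin] at c1
    have c2 : ∀ μ : Fin d, (∑ j : Fin d → Fin L, ∑ s ∈ range L, ∑ r ∈ range L, ‖Dh μ (bpt L N y j - tstep (fine L N) μ s + tstep (fine L N) μ r)‖) ^ 2
        ≤ (L : ℝ) ^ d * ∑ j : Fin d → Fin L, (∑ s ∈ range L, ∑ r ∈ range L, ‖Dh μ (bpt L N y j - tstep (fine L N) μ s + tstep (fine L N) μ r)‖) ^ 2 := by
      intro μ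
      have c := sq_sum_le_card_mul Finset.univ (fun j : Fin d → Fin L => ∑ s ∈ range L, ∑ r ∈ range L,
        ‖Dh μ (bpt L N y j - tstep (fine L N) μ s + tstep (fine L N) μ r)‖)
      rwa [Finset.card_univ, Fintype.card_fun, Fintype.card_fin, Fintype.card_fin, Nat.cast_pow] at c
    have c3 : ∀ (μ : Fin d) (j : Fin d → Fin L), (∑ s ∈ range L, ∑ r ∈ range L, ‖Dh μ (bpt L N y j - tstep (fine L N) μ s + tstep (fine L N) μ r)‖) ^ 2
        ≤ (L : ℝ) * ∑ s ∈ range L, (∑ r ∈ range L, ‖Dh μ (bpt L N y j - tstep (fine L N) μ s + tstep (fine L N) μ r)‖) ^ 2 := by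
      intro μ j
      have c := sq_sum_le_card_mul (range L) (fun s => ∑ r ∈ range L, ‖Dh μ (bpt L N y j - tstep (fine L N) μ s + tstep (fine L N) μ r)‖)
      rwa [card_range] at c
    have c4 : ∀ (μ : Fin d) (j : Fin d → Fin L) (s : ℕ), (∑ r ∈ range L, ‖Dh μ (bpt L N y j - tstep (fine L N) μ s + tstep (fine L N) μ r)‖) ^ 2
        ≤ (L : ℝ) * ∑ r ∈ range L, ‖Dh μ (bpt L N y j - tstep (fine L N) μ s + tstep (fine L N) μ r)‖ ^ 2 := by
      intro μ j s
      have c := sq_sum_le_card_mul (range L) (fun r => ‖Dh μ (bpt L N y j - tstep (fine L N) μ s + tstep (fine L N) μ r)‖)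
      rwa [card_range] at c
    calc _ ≤ (d : ℝ) * ∑ μ : Fin d, (∑ j : Fin d → Fin L, ∑ s ∈ range L, ∑ r ∈ range L, ‖Dh μ (bpt L N y j - tstep (fine L N) μ s + tstep (fine L N) μ r)‖) ^ 2 := c1
      _ ≤ (d : ℝ) * ∑ μ : Fin d, ((L : ℝ) ^ d * ∑ j : Fin d → Fin L, ((L : ℝ) * ∑ s ∈ range L, ((L : ℝ) * ∑ r ∈ range L,
            ‖Dh μ (bpt L N y j - tstep (fine L N) μ s + tstep (fine L N) μ r)‖ ^ 2))) := by
          gcongr with μ _ 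
          refine (c2 μ).trans ?_
          gcongr with j _
          refine (c3 μ j).trans ?_
          gcongr with s _
          exact c4 μ j s
      _ = _ := by simp only [mul_sum]
  -- §c summing over `y`: the block bijection + translation invariance, `L·L` copies of `Σ_x ‖Dh_μ x‖²`
  have hsum : ∑ y : Tor N, ∑ μ : Fin d, ∑ j : Fin d → Fin L, ∑ s ∈ range L, ∑ r ∈ range L,
        ‖Dh μ (bpt L N y j - tstep (fine L N) μ s + tstep (fine L N) μ r)‖ ^ 2
      = (L : ℝ) * L * ∑ μ : Fin d, ∑ x : Tor (fine L N), ‖Dh μ x‖ ^ 2 := by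
    calc _ = ∑ μ : Fin d, ∑ s ∈ range L, ∑ r ∈ range L, ∑ y : Tor N, ∑ j : Fin d → Fin L,
            ‖Dh μ (bpt L N y j + (tstep (fine L N) μ r - tstep (fine L N) μ s))‖ ^ 2 := by
          rw [Finset.sum_comm]
          refine sum_congr rfl fun μ _ => ?_
          calc ∑ y : Tor N, ∑ j : Fin d → Fin L, ∑ s ∈ range L, ∑ r ∈ range L, ‖Dh μ (bpt L N y j - tstep (fine L N) μ s + tstep (fine L N) μ r)‖ ^ 2
              = ∑ y : Tor N, ∑ s ∈ range L, ∑ r ∈ range L, ∑ j : Fin d → Fin L, ‖Dh μ (bpt L N y j + (tstep (fine L N) μ r - tstep (fine L N) μ s))‖ ^ 2 := by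
                refine sum_congr rfl fun y _ => ?_
                rw [Finset.sum_comm]
                refine sum_congr rfl fun s _ => ?_
                rw [Finset.sum_comm]
                refine sum_congr rfl fun r _ => sum_congr rfl fun j _ => by rw [show bpt L N y j - tstep (fine L N) μ s + tstep (fine L N) μ r = bpt L N y j + (tstep (fine L N) μ r - tstep (fine L N) μ s) by abel]
            _ = _ := by
                rw [Finset.sum_comm]
                refine sum_congr rfl fun s _ => ?_
                rw [Finset.sum_comm]
      _ = ∑ μ : Fin d, ∑ _s ∈ range L, ∑ _r ∈ range L, ∑ x : Tor (fine L N), ‖Dh μ x‖ ^ 2 := by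
          refine sum_congr rfl fun μ _ => sum_congr rfl fun s _ => sum_congr rfl fun r _ => ?_
          exact sum_blocks_translate L N (fun x => ‖Dh μ x‖ ^ 2) _
      _ = _ := by
          simp only [sum_const, card_range, nsmul_eq_mul]
          rw [mul_sum]
          exact sum_congr rfl fun μ _ => by ring
  -- §d the second differences are one diagonal entry of `hessV`
  have hdiag : ∑ μ : Fin d, ∑ x : Tor (fine L N), ‖Dh μ x‖ ^ 2 ≤ hessV (fine L N) (fun _ _ => (1 : E →L[ℂ] E)) g := by
    refine le_trans (le_of_eq ?_) (sum_diag_le_hessV (fun _ _ => (1 : E →L[ℂ] E)) g)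
    refine sum_congr rfl fun μ _ => ?_
    calc ∑ x : Tor (fine L N), ‖Dh μ x‖ ^ 2
        = ∑ x : Tor (fine L N), ‖cDv (fine L N) (fun _ _ => (1 : E →L[ℂ] E))
            (fun z => cDv (fine L N) (fun _ _ => (1 : E →L[ℂ] E)) (fun x => g x μ) z μ) (x - unitVec (fine L N) μ) μ‖ ^ 2 := by
          refine sum_congr rfl fun x _ => ?_
          simp only [hDh, hh]
          rw [norm_diff_h_eq]
      _ = ∑ x : Tor (fine L N), ‖cDv (fine L N) (fun _ _ => (1 : E →L[ℂ] E))
            (fun z => cDv (fine L N) (fun _ _ => (1 : E →L[ℂ] E)) (fun x => g x μ) z μ) x μ‖ ^ 2 :=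
          Fintype.sum_equiv (Equiv.subRight (unitVec (fine L N) μ)) _ _ (fun x => rfl)
  -- §e assemble
  calc _ ≤ ∑ y : Tor N, (((L : ℝ) ^ (d + 1))⁻¹ * (2 * (L : ℝ) * ∑ μ : Fin d, ∑ j : Fin d → Fin L, ∑ s ∈ range L, ∑ r ∈ range L,
          ‖Dh μ (bpt L N y j - tstep (fine L N) μ s + tstep (fine L N) μ r)‖)) ^ 2 :=
        sum_le_sum fun y _ => pow_le_pow_left₀ (norm_nonneg _) (hpt y) 2
    _ ≤ ∑ y : Tor N, (((L : ℝ) ^ (d + 1))⁻¹ * (2 * (L : ℝ))) ^ 2 * (d * ((L : ℝ) ^ d * (L * (L * ∑ μ : Fin d, ∑ j : Fin d → Fin L, ∑ s ∈ range L, ∑ r ∈ range L,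
          ‖Dh μ (bpt L N y j - tstep (fine L N) μ s + tstep (fine L N) μ r)‖ ^ 2)))) := by
        refine sum_le_sum fun y _ => ?_
        rw [← mul_assoc, mul_pow]
        exact mul_le_mul_of_nonneg_left (hcs y) (sq_nonneg _)
    _ = (((L : ℝ) ^ (d + 1))⁻¹ * (2 * (L : ℝ))) ^ 2 * (d * ((L : ℝ) ^ d * (L * (L * ((L : ℝ) * L * ∑ μ : Fin d, ∑ x : Tor (fine L N), ‖Dh μ x‖ ^ 2))))) := by
        rw [← hsum]; simp only [mul_sum]
    _ ≤ (((L : ℝ) ^ (d + 1))⁻¹ * (2 * (L : ℝ))) ^ 2 * (d * ((L : ℝ) ^ d * (L * (L * ((L : ℝ) * L * hessV (fine L N) (fun _ _ => (1 : E →L[ℂ] E)) g))))) := by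
        gcongr
    _ = 4 * d * (L : ℝ) ^ 4 * ((L : ℝ) ^ d)⁻¹ * hessV (fine L N) (fun _ _ => (1 : E →L[ℂ] E)) g := by
        field_simp
        ring

/-! ## §4 END units: the `hDIV` binder of file 5 at flat data, `ε_D = 2√d∕n` -/

/-- **DIV-AVG AT FLAT DATA IN THE END's UNITS** (`N := fine n M`): `√((n^d)⁻¹n²)·‖toLp(div(Q₁ g)) − toLp(L•Q₀(div g))‖ ≤ (2√d·n⁻¹)·√(((nL)⁴∕(nL)^d)·hessV 1 g)` —
the `hDIV` binder of `VariationalVectorAvgGProjG.avgG_projG_of_divAvg` with `ε_D = 2√d∕n` and `ρ_D` the level-`nL` `rhoV`-shape regularity functional. [folklore] -/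
theorem divAvg_flat (n : ℕ) [NeZero n] (M : Fin d → ℕ) [∀ μ, NeZero (M μ)] (g : Tor (fine L (fine n M)) → Fin d → E) :
    Real.sqrt (((n : ℝ) ^ d)⁻¹ * (n : ℝ) ^ 2)
        * ‖toLp 2 (divV (fine n M) (fun _ _ => (1 : E →L[ℂ] E)) (QvL L (fine n M) (fun _ _ _ _ => (1 : E →L[ℂ] E)) g))
            - toLp 2 (fun y => (L : ℂ) • Qcv L (fine n M) (fun _ => (1 : E →L[ℂ] E)) (divV (fine L (fine n M)) (fun _ _ => (1 : E →L[ℂ] E)) g) y)‖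
      ≤ (2 * Real.sqrt d * (n : ℝ)⁻¹)
        * Real.sqrt ((((n : ℝ) * L) ^ 4 / ((n : ℝ) * L) ^ d) * hessV (fine L (fine n M)) (fun _ _ => (1 : E →L[ℂ] E)) g) := by
  have hn : (0 : ℝ) < n := by exact_mod_cast Nat.pos_of_ne_zero (NeZero.ne n)
  have hL : (0 : ℝ) < L := by exact_mod_cast Nat.pos_of_ne_zero (NeZero.ne L)
  have hH : 0 ≤ hessV (fine L (fine n M)) (fun _ _ => (1 : E →L[ℂ] E)) g := by
    unfold hessV; exact sum_nonneg fun ν _ => hessv_nonneg _ _ _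
  have hsq := divAvg_flat_sq_le L (fine n M) g
  have hlhs0 : 0 ≤ Real.sqrt (((n : ℝ) ^ d)⁻¹ * (n : ℝ) ^ 2)
      * ‖toLp 2 (divV (fine n M) (fun _ _ => (1 : E →L[ℂ] E)) (QvL L (fine n M) (fun _ _ _ _ => (1 : E →L[ℂ] E)) g))
          - toLp 2 (fun y => (L : ℂ) • Qcv L (fine n M) (fun _ => (1 : E →L[ℂ] E)) (divV (fine L (fine n M)) (fun _ _ => (1 : E →L[ℂ] E)) g) y)‖ := by
    positivity
  have hrhs0 : 0 ≤ (2 * Real.sqrt d * (n : ℝ)⁻¹)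
      * Real.sqrt ((((n : ℝ) * L) ^ 4 / ((n : ℝ) * L) ^ d) * hessV (fine L (fine n M)) (fun _ _ => (1 : E →L[ℂ] E)) g) := by positivity
  rw [← Real.sqrt_sq hlhs0, ← Real.sqrt_sq hrhs0]
  refine Real.sqrt_le_sqrt ?_
  have hB : 0 ≤ (((n : ℝ) * L) ^ 4 / ((n : ℝ) * L) ^ d) * hessV (fine L (fine n M)) (fun _ _ => (1 : E →L[ℂ] E)) g := by positivity
  have hA : 0 ≤ ((n : ℝ) ^ d)⁻¹ * (n : ℝ) ^ 2 := by positivity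
  rw [mul_pow, mul_pow, mul_pow, mul_pow, Real.sq_sqrt hA, Real.sq_sqrt (Nat.cast_nonneg d), Real.sq_sqrt hB, ← toLp_sub, norm_toLp_sq]
  have e : ∑ y, ‖(divV (fine n M) (fun _ _ => (1 : E →L[ℂ] E)) (QvL L (fine n M) (fun _ _ _ _ => (1 : E →L[ℂ] E)) g)
        - fun y => (L : ℂ) • Qcv L (fine n M) (fun _ => (1 : E →L[ℂ] E)) (divV (fine L (fine n M)) (fun _ _ => (1 : E →L[ℂ] E)) g) y) y‖ ^ 2
      = ∑ y, ‖divV (fine n M) (fun _ _ => (1 : E →L[ℂ] E)) (QvL L (fine n M) (fun _ _ _ _ => (1 : E →L[ℂ] E)) g) y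
        - (L : ℂ) • Qcv L (fine n M) (fun _ => (1 : E →L[ℂ] E)) (divV (fine L (fine n M)) (fun _ _ => (1 : E →L[ℂ] E)) g) y‖ ^ 2 := rfl
  rw [e]
  calc ((n : ℝ) ^ d)⁻¹ * (n : ℝ) ^ 2 * ∑ y, ‖divV (fine n M) (fun _ _ => (1 : E →L[ℂ] E)) (QvL L (fine n M) (fun _ _ _ _ => (1 : E →L[ℂ] E)) g) y
          - (L : ℂ) • Qcv L (fine n M) (fun _ => (1 : E →L[ℂ] E)) (divV (fine L (fine n M)) (fun _ _ => (1 : E →L[ℂ] E)) g) y‖ ^ 2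
      ≤ ((n : ℝ) ^ d)⁻¹ * (n : ℝ) ^ 2 * (4 * d * (L : ℝ) ^ 4 * ((L : ℝ) ^ d)⁻¹ * hessV (fine L (fine n M)) (fun _ _ => (1 : E →L[ℂ] E)) g) :=
        mul_le_mul_of_nonneg_left hsq (by positivity)
    _ = 2 ^ 2 * (d : ℝ) * ((n : ℝ)⁻¹) ^ 2 * ((((n : ℝ) * L) ^ 4 / ((n : ℝ) * L) ^ d) * hessV (fine L (fine n M)) (fun _ _ => (1 : E →L[ℂ] E)) g) := by
        rw [mul_pow, mul_pow]
        field_simp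
        ring

end Summit.QuantumFields.BalabanUV.T4Continuum.VariationalVectorDivAvgFlat

end
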